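import Summits.BirchSwinnertonDyer.BirchSwinnertonDyer.Theorems.ByReductionTypeAtTwoTowerLayerLocal
import Literature.NumberTheory.GaloisRepresentations.CyclotomicTowerLocalIndex
import Literature.NumberTheory.EllipticCurves.CyclotomicZpExtension
import Literature.NumberTheory.EllipticCurves.ZpExtensionUnitTwistProofs
import Summits.BirchSwinnertonDyer.Rank1Residual.Additive.ZpTowerPlaceCountCore
import Mathlib.NumberTheory.Multiplicity
import HarnessLib

/-!
# The SHARP covering sets at the odd places: the number of primes of `ℚ_n` above `ℓ` in the
# cyclotomic `ℤ₂`-tower is `2^{min(n, v₂(ℓ² - 1) - 3)}` (route ByReductionTypeAtTwo, crux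
# `OrdKatoHalfAtTwo`, item stmt-BirchSwinnertonDyer-19271; seat bsd-2adic-tower-1 GEN 2,
# D-0074 (T1) «[2]-level control at p = 2», part 5)

HONEST FRAMING (cell `bsd-2adic`, run/shared/lean/pub/bsd-2adic/, HUMAN RULINGS D-0036/D-0074): THEOREMS
ONLY; nothing asserted; no definition; no new named fact; closes nothing by itself. Pure Galois
bookkeeping feeding the local error terms of the TOWER gap certificate.

Part 3a (`…TowerLayerLocal.lean`, GEN 0) bounds the finite-layer count by
`#A_n[p] ≤ #Sel_{p^∞}(E/K_n)[p] · ∏_{v ∈ S} C_v^{#R_v}` with covering sets `R_v ⊆ Γ_K`,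
`Γ_K = ⋃_{ρ ∈ R_v} res_v(Γ_{K_v}) ρ Γ_{K_n}` — one `ρ` per prime of `K_n` above `v` —, and proves
only the CRUDE cover `#R_v = pⁿ` at `v ∤ p` (sharp `R_v = {1}` at `p` over `ℚ`). At `p = 2` the crude
exponent `2^{j'}` makes every non-trivial local constant at an odd bad prime fatal at the layers
`ℚ(ζ₁₆)⁺`, `ℚ(ζ₃₂)⁺` (GEN 0's CERT-SPEC §4). Here the SHARP count is proved:

* §1 `exists_cover_of_norm_apply_resGal` (any `K`, `p`, `κ`, `K`-field `E`): if some `δ₀ ∈ Γ_E` has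
  `‖κ(res δ₀)‖ = p^{-e}` then covers of size **`p^{min(n, e)}`** exist at every layer `n`
  (representatives `κ ρ_i = i`, `i < p^{min(n,e)}`, and powers of `δ₀`).
* §2 `norm_ell_two`: the valuation of the tree's normalised logarithm `ℓ : ℤ_pˣ → ℤ_p`
  (`CyclotomicZp.ell`) at `p = 2`: `‖ℓ(u)‖ = 8 ‖u² - 1‖` (the tree's `ZpTower.norm_ell_mul`, cell
  `b2b-bsdres`, whose place count `ZpTowerPlaceCount*.lean` treats ODD `p` in the currency of places
  of the number field `ℚ_n`; here `p = 2` in the covering-set currency of part 3a).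
* §3 `norm_toAdd_apply_resGal_mul_of_isAbsArithFrob` (+ `_two`): for a cyclotomic `κ` of `ℚ` and a
  LOCAL arithmetic Frobenius `τ ∈ Γ_{ℚ_v}`, `v ∌ p`: `‖κ(res τ)‖ ‖t‖ ‖p^{e₀}‖ = ‖(N v)^t - 1‖` (tree
  `ZpTower.norm_toAdd_frob_mul_of_isCyclotomic` + `isArithFrobAt_absGaloisRestrict_adicCompletionPrime_iff`),
  whence `‖κ(res τ)‖ = 2^{-(v₂(ℓ² - 1) - 3)}` at `p = 2`, `ℓ = natGenerator v`.
* §4 **`exists_sharp_cover_odd_two`**: for the cyclotomic `ℤ₂`-extension of `ℚ`, an odd place `v`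
  and every `n`, a cover with `#R = 2^{min(n, v₂(ℓ² - 1) - 3)}` (and `exists_cover_card_le_odd_two`,
  the `≤` form consumed by `KatoHalfPinch.towerGapAtTwo_of_localKernelBounds`, hypothesis `hN`).
  `ℓ ≡ ±3 (mod 8)` ⇒ ONE prime above `ℓ` in every layer; `ℓ ≡ ±7 (mod 16)` ⇒ at most `2`; etc.

Not here: the gap bridges / doors with the sharp exponent (part 6, `…TowerLayerSharp.lean`); odd `p`
(the same proof gives `p^{min(n, v_p(ℓ^{p-1} - 1) - 1)}`; not needed by the `2`-adic programme).

References: L. Washington, *Introduction to Cyclotomic Fields* (1997), §13.1; J.-P. Serre, *A Course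
in Arithmetic*, II §3.2 Prop. 8; J.-P. Serre, *Abelian ℓ-adic representations* (1968), I §1.2;
J. Neukirch, *Algebraic Number Theory*, I §9 (9.4) (number of primes = index of the decomposition
group in an abelian extension).
-/

set_option autoImplicit false

noncomputable section

open scoped Classical

open NumberField IsDedekindDomain Field Literature.NumberTheory.EllipticCurves
  Literature.NumberTheory.GaloisRepresentations

universe u

namespace Summit.BirchSwinnertonDyer.BirchSwinnertonDyer.Theorems.TowerLayer

/-! ## §1 Covers from ONE local element of known `κ`-valuation -/

section Abstract

variable {K : Type u} [Field K] {p : ℕ} [hp : Fact p.Prime] (κ : ZpExtension K p)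
  (E : Type u) [Field E] [Algebra K E]

/-- Bookkeeping in `ℤ_p`: every `c` is `i + p^m w` with `i < p^m` a natural number
(`i = (c mod p^m).val`). [folklore] -/
theorem exists_nat_lt_and_dvd_sub (m : ℕ) (c : ℤ_[p]) :
    ∃ i : ℕ, i < p ^ m ∧ (p : ℤ_[p]) ^ m ∣ c - i := by
  refine ⟨(PadicInt.toZModPow m c).val, ZMod.val_lt _, ?_⟩
  rw [← Ideal.mem_span_singleton, ← PadicInt.ker_toZModPow, RingHom.mem_ker, map_sub,
    map_natCast, ZMod.natCast_zmod_val, sub_self]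

/-- **Covering sets from one local element.** Let `κ : Γ_K ↠ ℤ_p` be a `ℤ_p`-extension, `E` a
`K`-field (a completion `K_v`) with restriction `res : Γ_E → Γ_K`, and suppose some `δ₀ ∈ Γ_E`
has `‖κ(res δ₀)‖ = p^{-e}`, i.e. `κ(res Γ_E) ⊇ p^e ℤ_p`. Then for every layer `n` there is a
finite set `R ⊆ Γ_K` with **`#R = p^{min(n, e)}`** such that `Γ_K = ⋃_{ρ ∈ R} res(Γ_E) ρ Γ_{K_n}`
(`Γ_{K_n} = κ⁻¹(pⁿℤ_p)`): take `ρ_i` with `κ ρ_i = i`, `0 ≤ i < p^{min(n,e)}`; for `σ` write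
`κ σ = i + p^{min(n,e)} w` and absorb `p^e w` modulo `pⁿ` by a power of `δ₀`. (The image of the
decomposition group in `Gal(K_n/K) ≅ ℤ/pⁿ` has index `p^{min(n,e)}` — the number of primes of
`K_n` above the place — when `κ(res Γ_E) = p^e ℤ_p`.) [cite: Washington1997, §13.1]
[cite: NeukirchANT1999, Ch. I §9 (9.4)] -/
theorem exists_cover_of_norm_apply_resGal (δ₀ : absoluteGaloisGroup E) {e : ℕ}
    (hδ₀ : ‖(κ (resGal (K := K) E δ₀)).toAdd‖ = (p : ℝ) ^ (-(e : ℤ))) (n : ℕ) :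
    ∃ R : Finset (absoluteGaloisGroup K), R.card = p ^ min n e ∧
      ∀ σ : absoluteGaloisGroup K, ∃ ρ ∈ R, ∃ δ : absoluteGaloisGroup E,
        ∃ τ ∈ κ.layerSubgroup n, σ = resGal (K := K) E δ * ρ * τ := by
  have hpp : p.Prime := hp.out
  -- representatives `ρ_i`, `κ ρ_i = i`
  have hρ : ∀ i : ℕ, ∃ ρ : absoluteGaloisGroup K, κ ρ = Multiplicative.ofAdd (i : ℤ_[p]) :=
    fun i ↦ κ.surjective _
  choose ρ hρ using hρ
  set m := min n e with hm
  refine ⟨(Finset.range (p ^ m)).image ρ, ?_, fun σ ↦ ?_⟩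
  · rw [Finset.card_image_of_injOn, Finset.card_range]
    intro i _ j _ hij
    have h := congrArg (fun g ↦ (κ g).toAdd) hij
    simp only [hρ, toAdd_ofAdd, Nat.cast_inj] at h
    exact h
  -- the local element: `κ(res δ₀) = p^e u`
  set x₀ : ℤ_[p] := (κ (resGal (K := K) E δ₀)).toAdd with hx₀
  have hx₀ne : x₀ ≠ 0 := by
    intro h
    rw [h, norm_zero] at hδ₀
    exact (zpow_pos (by exact_mod_cast hpp.pos) _).ne' hδ₀.symm
  have hval : x₀.valuation = e := by
    have h := PadicInt.norm_eq_zpow_neg_valuation hx₀ne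
    rw [hδ₀] at h
    have h' := zpow_right_injective₀ (by exact_mod_cast hpp.pos) (by exact_mod_cast hpp.ne_one) h
    simp only [neg_inj, Nat.cast_inj] at h'
    exact h'.symm
  obtain ⟨u, hu⟩ : ∃ u : ℤ_[p]ˣ, x₀ = (p : ℤ_[p]) ^ e * u :=
    ⟨PadicInt.unitCoeff hx₀ne, by rw [mul_comm, ← hval]; exact PadicInt.unitCoeff_spec hx₀ne⟩
  -- `κ σ = i + p^m w`
  obtain ⟨i, hi, w, hw⟩ := exists_nat_lt_and_dvd_sub m (κ σ).toAdd
  -- the exponent `k` of `δ₀`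
  obtain ⟨k, hk⟩ : ∃ k : ℕ, (p : ℤ_[p]) ^ n ∣ (p : ℤ_[p]) ^ m * w - k * x₀ := by
    rcases le_or_gt e n with hen | hne
    · have hme : m = e := by rw [hm, min_eq_right hen]
      obtain ⟨k, -, y, hy⟩ := exists_nat_lt_and_dvd_sub (n - e) (w * ((u⁻¹ : ℤ_[p]ˣ) : ℤ_[p]))
      refine ⟨k, u * y, ?_⟩
      rw [hme, hu]
      have : (p : ℤ_[p]) ^ n = (p : ℤ_[p]) ^ e * (p : ℤ_[p]) ^ (n - e) := by
        rw [← pow_add, Nat.add_sub_cancel' hen]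
      rw [this]
      have hw' : w = (w * ((u⁻¹ : ℤ_[p]ˣ) : ℤ_[p])) * u := by rw [Units.inv_mul_cancel_right]
      rw [hw']
      linear_combination (p : ℤ_[p]) ^ e * (u : ℤ_[p]) * hy
    · refine ⟨0, w, ?_⟩
      have hmn : m = n := by rw [hm, min_eq_left hne.le]
      rw [hmn, Nat.cast_zero, zero_mul, sub_zero]
  refine ⟨ρ i, Finset.mem_image.mpr ⟨i, Finset.mem_range.mpr hi, rfl⟩, δ₀ ^ k,
    (resGal (K := K) E (δ₀ ^ k) * ρ i)⁻¹ * σ, ?_, ?_⟩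
  · have hval : (κ ((resGal (K := K) E (δ₀ ^ k) * ρ i)⁻¹ * σ)).toAdd =
        (κ σ).toAdd - (k * x₀ + i) := by
      rw [hx₀]
      simp only [map_mul, map_inv, map_pow, hρ, toAdd_mul, toAdd_inv, toAdd_pow, toAdd_ofAdd,
        nsmul_eq_mul]
      ring
    rw [ZpExtension.mem_layerSubgroup, hval]
    obtain ⟨y, hy⟩ := hk
    exact ⟨y, by linear_combination hw + hy⟩
  · rw [mul_inv_cancel_left]

end Abstract

/-! ## §2 The normalised logarithm `ℓ = log_p / log_p(γ_cyc)`: `‖ℓ(u)‖ · ‖t‖ · ‖p^{e₀}‖ = ‖u^t - 1‖` -/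

section Ell

open Literature.NumberTheory.EllipticCurves.CyclotomicZp Summit.BirchSwinnertonDyer.Rank1Residual.Additive

/-- **The valuation of the normalised logarithm at `p = 2`.** The tree's `ZpTower.norm_ell_mul`
(`‖ℓ(u)‖ · ‖t‖ · ‖p^{e₀}‖ = ‖u^t - 1‖`, `ℓ = CyclotomicZp.ell p`, `γ_cyc^{t ℓ(u)} = u^t`) read at
`p = 2` (`t = 2`, `e₀ = 2`): **`‖ℓ(u)‖ = 8 · ‖u² - 1‖`**, i.e. `v₂(ℓ(u)) = v₂(u² - 1) - 3`.
[cite: Serre1973, Ch. II §3.2 Prop. 8] [cite: Washington1997, §13.1] -/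
theorem norm_ell_two (u : ℤ_[2]ˣ) : ‖ell 2 u‖ = 8 * ‖(u : ℤ_[2]) ^ 2 - 1‖ := by
  have h := ZpTower.norm_ell_mul 2 u
  have ht : torsionOrder 2 = 2 := by decide
  have he : cyclotomicExponent 2 = 2 := by decide
  have h2 : ‖((2 : ℕ) : ℤ_[2])‖ = 2⁻¹ := by exact_mod_cast PadicInt.norm_p (p := 2)
  rw [ht, he, norm_pow, h2] at h
  rw [← h]; ring

end Ell

/-! ## §3 A cyclotomic `κ` over `ℚ`: `‖κ σ‖ = ‖ℓ(χ_p σ)‖`; the value on a Frobenius -/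

section Cyclotomic

open Literature.NumberTheory.EllipticCurves.CyclotomicZp
  Literature.NumberTheory.GaloisRepresentations.IsNonarchimedeanLocalField
  Summit.BirchSwinnertonDyer.Rank1Residual.Additive

variable {p : ℕ} [hp : Fact p.Prime]

/-- **The cyclotomic `ℤ_p`-extension on a Frobenius at `v ∤ p`:
`‖κ(Frob_v)‖ · ‖t‖ · ‖p^{e₀}‖ = ‖(N v)^t - 1‖`.** For the cyclotomic `κ` of `ℚ`, a finite place
`v ∌ p` and an (absolute) arithmetic Frobenius `τ ∈ Γ_{ℚ_v}` (tree `IsAbsArithFrob`,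
`exists_isAbsArithFrob_holds`): `χ_p(res_v τ) = N v` (tree
`GaloisRep.cyclotomicCharacter_apply_of_isArithFrobAt`, Serre) and §2. In words: `ℓ = N v` is
unramified in `ℚ_∞/ℚ` and its decomposition group in `Gal(ℚ_∞/ℚ) ≅ ℤ_p` is
`p^{v_p(ℓ^t - 1) - v_p(t) - e₀} ℤ_p`. This is the tree's `ZpTower.norm_toAdd_frob_mul_of_isCyclotomic`
(cell `b2b-bsdres`, global Frobenius at a prime `𝔓 ∣ v` of `ℤ̄`) transported to the LOCAL Frobenius
of the covering-set currency (`isArithFrobAt_absGaloisRestrict_adicCompletionPrime_iff`).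
[cite: SerreAbelianLadic1968, Ch. I §1.2 (Example: the cyclotomic character)] [cite: Washington1997, §13.1] -/
theorem norm_toAdd_apply_resGal_mul_of_isAbsArithFrob {κ : ZpExtension ℚ p} (hκ : κ.IsCyclotomic)
    (v : HeightOneSpectrum (𝓞 ℚ)) (hpv : ((p : ℕ) : 𝓞 ℚ) ∉ v.asIdeal)
    {τ : absoluteGaloisGroup (v.adicCompletion ℚ)} (hτ : IsAbsArithFrob τ) :
    ‖(κ (resGal (K := ℚ) (v.adicCompletion ℚ) τ)).toAdd‖ * ‖((torsionOrder p : ℕ) : ℤ_[p])‖ *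
        ‖(p : ℤ_[p]) ^ cyclotomicExponent p‖ =
      ‖((v.residueCard : ℕ) : ℤ_[p]) ^ torsionOrder p - 1‖ := by
  have hq : residueFieldCard (v.adicCompletion ℚ) = Nat.card (𝓞 ℚ ⧸ v.asIdeal) := by
    rw [Literature.NumberTheory.Automorphic.residueFieldCard_adicCompletion_eq,
      HeightOneSpectrum.residueCard_eq_card_quotient]
  have hfrob := (isArithFrobAt_absGaloisRestrict_adicCompletionPrime_iff ℚ v hq τ).2 hτ
  exact ZpTower.norm_toAdd_frob_mul_of_isCyclotomic p κ hκ hpv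
    (adicCompletionPrime_mem_primesAbove ℚ v) hfrob

/-- **`p = 2`: `‖κ(Frob_v)‖ = 2^{-(v₂(ℓ² - 1) - 3)}`** for the cyclotomic `ℤ₂`-extension `κ` of `ℚ`,
an odd place `v` with rational prime `ℓ = Rat.HeightOneSpectrum.natGenerator v` (`= N v`), and an
arithmetic Frobenius `τ ∈ Γ_{ℚ_v}`: `‖κ(res τ)‖ = ‖ℓ(χ₂(res τ))‖ = 8 ‖ℓ² - 1‖₂` (`ℓ² ≡ 1 (mod 8)`).
That is, the decomposition group of `ℓ` in `Gal(ℚ_∞/ℚ) ≅ ℤ₂` is `2^{v₂(ℓ² - 1) - 3} ℤ₂` (`ℓ ≡ ±3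
(mod 8)`: all of it; `ℓ = 7, 17, 31, …`: index `2, 4, 8, …`). [cite: Washington1997, §13.1]
[cite: Serre1973, Ch. II §3.2 Prop. 8] [cite: SerreAbelianLadic1968, Ch. I §1.2 (Example: the cyclotomic character)] -/
theorem norm_toAdd_apply_resGal_of_isAbsArithFrob_two {κ : ZpExtension ℚ 2} (hκ : κ.IsCyclotomic)
    (v : HeightOneSpectrum (𝓞 ℚ)) (h2v : ((2 : ℕ) : 𝓞 ℚ) ∉ v.asIdeal)
    {τ : absoluteGaloisGroup (v.adicCompletion ℚ)} (hτ : IsAbsArithFrob τ) :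
    ‖(κ (resGal (K := ℚ) (v.adicCompletion ℚ) τ)).toAdd‖ =
      (2 : ℝ) ^ (-((padicValNat 2 (Rat.HeightOneSpectrum.natGenerator v ^ 2 - 1) - 3 : ℕ) : ℤ)) := by
  set ℓ := Rat.HeightOneSpectrum.natGenerator v with hℓdef
  have hℓp : ℓ.Prime := Rat.HeightOneSpectrum.prime_natGenerator v
  -- `χ₂(res τ) = N v = ℓ`
  have hq : residueFieldCard (v.adicCompletion ℚ) = Nat.card (𝓞 ℚ ⧸ v.asIdeal) := by
    rw [Literature.NumberTheory.Automorphic.residueFieldCard_adicCompletion_eq,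
      HeightOneSpectrum.residueCard_eq_card_quotient]
  have hfrob := (isArithFrobAt_absGaloisRestrict_adicCompletionPrime_iff ℚ v hq τ).2 hτ
  have hχ : ((GaloisRep.cyclotomicCharacter ℚ 2 (resGal (K := ℚ) (v.adicCompletion ℚ) τ) :
      ℤ_[2]ˣ) : ℤ_[2]) = (ℓ : ℤ_[2]) := by
    have h := GaloisRep.cyclotomicCharacter_apply_of_isArithFrobAt (ℓ := 2) h2v
      (adicCompletionPrime_mem_primesAbove ℚ v) hfrob
    rw [Rat.residueCard_eq_natGenerator] at h
    exact h
  -- `ℓ` is odd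
  have hodd : ¬ 2 ∣ ℓ := by
    intro h2
    have h2' : ℓ = 2 := ((Nat.prime_dvd_prime_iff_eq Nat.prime_two hℓp).mp h2).symm
    exact h2v ((Rat.natCast_mem_asIdeal_iff (v := v)).mpr (by rw [← hℓdef, h2']))
  have hN : ℓ ^ 2 - 1 ≠ 0 := by
    have : 1 < ℓ ^ 2 := by nlinarith [hℓp.one_lt]
    omega
  have h3 : 3 ≤ padicValNat 2 (ℓ ^ 2 - 1) :=
    (padicValNat_dvd_iff_le hN).mp
      (Nat.eight_dvd_sq_sub_one_of_odd (Nat.odd_iff.mpr (Nat.two_dvd_ne_zero.mp hodd)))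
  -- the norm of the natural number `ℓ² - 1` in `ℤ_2`
  have hnat : ‖((ℓ ^ 2 - 1 : ℕ) : ℤ_[2])‖ = (2 : ℝ) ^ (-(padicValNat 2 (ℓ ^ 2 - 1) : ℤ)) := by
    rw [PadicInt.norm_def, PadicInt.coe_natCast,
      Padic.norm_eq_zpow_neg_valuation (by exact_mod_cast hN), Padic.valuation_natCast]
    norm_num
  have hcast : ((ℓ : ℤ_[2]) ^ 2 - 1) = ((ℓ ^ 2 - 1 : ℕ) : ℤ_[2]) := by
    rw [Nat.cast_sub (Nat.one_le_pow _ _ hℓp.pos), Nat.cast_pow, Nat.cast_one]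
  rw [ZpTower.norm_toAdd_eq_norm_ell_of_isCyclotomic 2 κ hκ, norm_ell_two, hχ, hcast, hnat,
    Nat.cast_sub h3,
    neg_sub]
  rw [show ((3 : ℕ) : ℤ) - (padicValNat 2 (ℓ ^ 2 - 1) : ℤ) =
      3 + (-(padicValNat 2 (ℓ ^ 2 - 1) : ℤ)) by ring, zpow_add₀ (by norm_num : (2 : ℝ) ≠ 0)]
  norm_num

end Cyclotomic

/-! ## §4 The SHARP covering sets at an odd place for `p = 2` -/

section Sharp

open Literature.NumberTheory.GaloisRepresentations.IsNonarchimedeanLocalField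

/-- **The sharp cover at an odd place `v` of `ℚ` in the cyclotomic `ℤ₂`-tower.** For the
cyclotomic `ℤ₂`-extension `κ` of `ℚ`, an odd place `v` with rational prime
`ℓ = Rat.HeightOneSpectrum.natGenerator v`, and every layer `n`, there is `R ⊆ Γ_ℚ` with
**`#R = 2^{min(n, v₂(ℓ² - 1) - 3)}`** and `Γ_ℚ = ⋃_{ρ ∈ R} res_v(Γ_{ℚ_v}) ρ Γ_{ℚ_n}` — the shape
consumed by `TowerLayer.natCard_layerClasses_le_of_localKernelBounds` (part 3a, hypothesis `hR`),
where GEN 0 used the crude transversal of size `2ⁿ` (`exists_cover_of_layerSubgroup`). Indeed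
`2^{min(n, v₂(ℓ² - 1) - 3)}` is the number of primes of `ℚ_n = ℚ(ζ_{2^{n+2}})⁺` above `ℓ`: `ℓ` is
unramified with Frobenius of `2`-adic valuation `v₂(ℓ² - 1) - 3` in `Gal(ℚ_∞/ℚ) ≅ ℤ₂` (§3), and
§1 applies to an arithmetic Frobenius `τ ∈ Γ_{ℚ_v}` (tree `exists_isAbsArithFrob_holds`).
Examples: `ℓ ≡ ±3 (mod 8)` ⇒ `#R = 1` at every layer (inert); `ℓ ≡ ±7 (mod 16)` ⇒ `#R ≤ 2`;
`ℓ ≡ ±15 (mod 32)` ⇒ `#R ≤ 4`. [cite: Washington1997, §13.1] [cite: NeukirchANT1999, Ch. I §9 (9.4)] -/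
theorem exists_sharp_cover_odd_two {κ : ZpExtension ℚ 2} (hκ : κ.IsCyclotomic)
    (v : HeightOneSpectrum (𝓞 ℚ)) (h2v : ((2 : ℕ) : 𝓞 ℚ) ∉ v.asIdeal) (n : ℕ) :
    ∃ R : Finset (absoluteGaloisGroup ℚ),
      R.card = 2 ^ min n (padicValNat 2 (Rat.HeightOneSpectrum.natGenerator v ^ 2 - 1) - 3) ∧
      ∀ σ : absoluteGaloisGroup ℚ, ∃ ρ ∈ R, ∃ δ : absoluteGaloisGroup (v.adicCompletion ℚ),
        ∃ τ ∈ κ.layerSubgroup n, σ = resGal (K := ℚ) (v.adicCompletion ℚ) δ * ρ * τ := by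
  obtain ⟨τ, hτ⟩ := exists_isAbsArithFrob_holds (F := v.adicCompletion ℚ)
  exact exists_cover_of_norm_apply_resGal κ (v.adicCompletion ℚ) τ
    (norm_toAdd_apply_resGal_of_isAbsArithFrob_two hκ v h2v hτ) n

/-- **Monotone form**: any `N ≥ 2^{min(n, v₂(ℓ² - 1) - 3)}` bounds the size of some cover (pad `R`
with arbitrary elements) — convenient when the certificate carries an upper bound `N_v` for the
number of primes above `v` rather than the exact count. [cite: Washington1997, §13.1] -/
theorem exists_cover_card_le_odd_two {κ : ZpExtension ℚ 2} (hκ : κ.IsCyclotomic)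
    (v : HeightOneSpectrum (𝓞 ℚ)) (h2v : ((2 : ℕ) : 𝓞 ℚ) ∉ v.asIdeal) (n : ℕ) :
    ∃ R : Finset (absoluteGaloisGroup ℚ),
      R.card ≤ 2 ^ min n (padicValNat 2 (Rat.HeightOneSpectrum.natGenerator v ^ 2 - 1) - 3) ∧
      ∀ σ : absoluteGaloisGroup ℚ, ∃ ρ ∈ R, ∃ δ : absoluteGaloisGroup (v.adicCompletion ℚ),
        ∃ τ ∈ κ.layerSubgroup n, σ = resGal (K := ℚ) (v.adicCompletion ℚ) δ * ρ * τ := by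
  obtain ⟨R, hR, hcov⟩ := exists_sharp_cover_odd_two hκ v h2v n
  exact ⟨R, hR.le, hcov⟩

end Sharp

end Summit.BirchSwinnertonDyer.BirchSwinnertonDyer.Theorems.TowerLayer

end
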